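import Summits.Langlands.Langlands.Theorems.MonomialConverseAbelianFreeBrauerLinear

/-!
# Abelian-free Brauer induction, III: the three moves and the hub assembly

Part of the sorry-free proof of the crux `Summit.Langlands.Langlands.Theses.MonomialConverse.AbelianFreeBrauer`
(item stmt-Langlands-18580, route-Langlands-MonomialConverse), split over the files
`MonomialConverseAbelianFreeBrauer{Span, Linear, Moves, Hubs, Affine, Expansion, Proof}` (landing
order; all definitions live in `Span`, the last file holds `abelianFreeBrauer_proof` and the proof
outline).  Everything is over the in-tree class-function library
`Literature.RepresentationTheory.FiniteGroups` (`indClassFun`, `classInner`, `virtChars`, `IsIrrChar`);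
no `sorry`, no new axioms, no `Prop`-valued definitions (predicates are sets).

Contents (`AFB⁰(M)` denotes `linOrth M ⊆ afSpan M`): the **engine** `indClassFun_mem_afSpan_of_orth`
(`Ind_M g ∈ J(G)` for `g ∈ R(M) ∩ (Λ(G)|_M)^⊥` given `AFB⁰(M)`); the **sandwich**
`indOne_sub_indOne_mem_afSpan` (`π_K - π_M ∈ J(G)` for `K ≤ M` absorbing); the **abelian-quotient
move** `indClassFun_restrict_mem_afSpan`; **quotient resolution** `indOne_sub_one_mem_afSpan_of_quotient`
(`π_K - 1 ∈ J(G)` for a covering `K ⊇ N ⊴ G` given `AFB⁰(G/N)`); and the **assembly at one group**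
`linOrth_subset_afSpan_of_hub`: a covering hub `H₀`, congruences `π_K ≡ π_{H₀}` (covering admissible
`K`) and `π_K ≡ e_K` with `e_K (π_{H₀} - 1) ∈ J`, `linPart (e_K μ) = e_K μ` (non-covering admissible
`K`), and an expansion of every virtual character along admissible subgroups, give `AFB⁰(G)`.

References: Serre (`SerreLinearRepresentations1977`) §7.2–7.4; Isaacs (`Isaacs1976`) Ch. 5.
-/

set_option linter.dupNamespace false

noncomputable section

open scoped BigOperators Pointwise

namespace Summit.Langlands.Langlands.Theorems.AbelianFreeBrauer

open Literature.RepresentationTheory.FiniteGroups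

variable {G : Type} [Group G]

/-! ### The three moves: the engine, the sandwich, the abelian-quotient move, quotient resolution -/

section Moves

variable [Fintype G]

/-- Restriction `R(G) → R(H)`. [folklore] -/
theorem restrict_mem_virtChars (H : Subgroup G) {f : G → ℂ} (hf : f ∈ virtChars G) :
    (fun x : H => f x) ∈ virtChars H := by
  rw [mem_virtChars] at hf
  refine AddSubgroup.closure_induction (p := fun g _ => (fun x : H => g x) ∈ virtChars H) ?_
    (Subring.zero_mem _) (fun _ _ _ _ hg hg' => Subring.add_mem _ hg hg')
    (fun _ _ hg => Subring.neg_mem _ hg) hf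
  intro χ hχ
  exact (IsIrrChar.isCharacter hχ).restrict H |>.mem_virtChars

/-- **The engine.** If `AFB⁰` holds for the subgroup `M` (`linOrth M ⊆ J(M)`), then `Ind_M^G g ∈ J(G)` for
every virtual character `g` of `M` orthogonal to all restrictions `μ|_M` of linear characters of `G`:
split `g = (g - linPart g) + Σ_θ ⟨g, θ⟩ θ`; the first part induces into `J(G)` by transitivity, an
abelian-free `θ` contributes an integer multiple of a generator, and a `θ = μ|_M` has coefficient
`⟨g, μ|_M⟩ = 0`. [folklore] -/
theorem indClassFun_mem_afSpan_of_orth (M : Subgroup G) [Fintype M]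
    (hAF : linOrth M ⊆ (afSpan M : Set (M → ℂ))) {g : M → ℂ} (hg : g ∈ virtChars M)
    (hvan : ∀ μ : G →* ℂˣ, classInner g (fun x : M => (μ x : ℂ)) = 0) :
    indClassFun M g ∈ afSpan G := by
  classical
  have hsplit : indClassFun M g =
      indClassFun M (g - linPart M g) + indClassFun M (linPart M g) := by
    rw [← indClassFun_add, sub_add_cancel]
  rw [hsplit]
  refine add_mem (indClassFun_mem_afSpan_of_mem M (hAF (sub_linPart_mem_linOrth hg))) ?_
  rw [linPart, indClassFun_sum]
  refine sum_mem fun θ hθ => ?_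
  rw [indClassFun_smul]
  obtain ⟨ν, rfl⟩ := exists_hom_of_mem_linF hθ
  by_cases haf : ∀ χ : G →* ℂˣ, χ.restrict M ≠ ν
  · obtain ⟨n, hn⟩ := exists_int_classInner_of_mem_virtChars hg (isIrrChar_coe ν)
    rw [hn]
    exact intCast_smul_mem_afSpan (indClassFun_mem_afSpan haf) n
  · push Not at haf
    obtain ⟨χ, hχ⟩ := haf
    have hfun : (fun x : M => (ν x : ℂ)) = fun x : M => (χ x : ℂ) := by
      funext x
      rw [← hχ, MonoidHom.restrict_apply]
    rw [hfun, hvan χ, zero_smul]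
    exact zero_mem _

/-- **The sandwich** (`K ≤ M`): if `AFB⁰(M)` and every linear character of `G` trivial on `K` is trivial
on `M`, then `π_K - π_M ∈ J(G)` (the engine applied to `π^M_K - 1 ∈ R(M)`). Instances: `K` covering
(any `M ⊇ K`), and `M = hull K`. [folklore] -/
theorem indOne_sub_indOne_mem_afSpan {K M : Subgroup G} [Fintype M] (hKM : K ≤ M)
    (hAF : linOrth M ⊆ (afSpan M : Set (M → ℂ)))
    (habs : ∀ μ : G →* ℂˣ, K ≤ μ.ker → M ≤ μ.ker) :
    indOne K - indOne M ∈ afSpan G := by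
  classical
  set K' := K.subgroupOf M with hK'
  have hg : indOne K' - 1 ∈ virtChars M :=
    Subring.sub_mem _ (indOne_mem_virtChars K') (Subring.one_mem _)
  have hind : indClassFun M (indOne K' - 1) = indOne K - indOne M := by
    rw [indClassFun_sub]
    congr 1
    exact indClassFun_indClassFun K M hKM (fun _ => 1)
  rw [← hind]
  refine indClassFun_mem_afSpan_of_orth M hAF hg fun μ => ?_
  rw [sub_eq_add_neg, classInner_add_left, ← neg_one_smul ℂ (1 : M → ℂ), classInner_smul_left]
  have h1 := classInner_indOne_coe K' (μ.restrict M)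
  have h2 := classInner_indOne_coe (⊤ : Subgroup M) (μ.restrict M)
  rw [indOne_top] at h2
  rw [show (fun x : M => (μ (x : G) : ℂ)) = fun x : M => ((μ.restrict M) x : ℂ) from rfl, h1, h2]
  by_cases hK : K' ≤ (μ.restrict M).ker
  · have hKμ : K ≤ μ.ker := fun k hk => by
      have h := hK (show (⟨k, hKM hk⟩ : M) ∈ K' from Subgroup.mem_subgroupOf.mpr hk)
      rw [MonoidHom.mem_ker, MonoidHom.restrict_apply] at h
      exact h
    have htop : (⊤ : Subgroup M) ≤ (μ.restrict M).ker := fun x _ => by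
      rw [MonoidHom.mem_ker, MonoidHom.restrict_apply]
      exact habs μ hKμ x.2
    rw [if_pos hK, if_pos htop]
    ring
  · have htop : ¬ (⊤ : Subgroup M) ≤ (μ.restrict M).ker := fun h => hK (le_top.trans h)
    rw [if_neg hK, if_neg htop]
    ring

/-- **The abelian-quotient move**: `N` normal with commutative quotient and `AFB⁰(N)`; for `x ∈ R(G)`
orthogonal to the linear characters, `Ind_N (x|_N) ∈ J(G)` (the engine: `⟨x|_N, μ|_N⟩_N = ⟨x, π_N μ⟩_G`
and `π_N μ = Σ_β (β∘π) μ` is a sum of linear characters). [folklore] -/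
theorem indClassFun_restrict_mem_afSpan (N : Subgroup G) [N.Normal] [Fintype N]
    (hc : IsMulCommutative (G ⧸ N)) (hAF : linOrth N ⊆ (afSpan N : Set (N → ℂ)))
    {x : G → ℂ} (hx : x ∈ linOrth G) : indClassFun N (fun n : N => x n) ∈ afSpan G := by
  classical
  have hxc : IsClassFun x := isClassFun_of_mem_virtChars hx.1
  refine indClassFun_mem_afSpan_of_orth N hAF (restrict_mem_virtChars N hx.1) fun μ => ?_
  rw [classInner_comm, ← classInner_indClassFun_left N (fun n : N => (μ n : ℂ)) hxc,
    indClassFun_restrict N (isCharacter_coe_monoidHom' μ).isClassFun]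
  change classInner (indOne N * fun g => (μ g : ℂ)) x = 0
  rw [indOne_eq_sum_comp_mk N hc, Finset.sum_mul, classInner_sum_left]
  refine Finset.sum_eq_zero fun β hβ => ?_
  rw [classInner_comm]
  exact hx.2 _ (mul_mem_linF (comp_mk_mem_linF N hc hβ) (coe_mem_linF μ))

/-- `π_N · x = Ind_N (x|_N)` for a class function `x`. [folklore] -/
theorem indOne_mul_eq_indClassFun_restrict (N : Subgroup G) {x : G → ℂ} (hx : IsClassFun x) :
    indOne N * x = indClassFun N (fun n : N => x n) :=
  (indClassFun_restrict N hx).symm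

omit [Fintype G] in
/-- The image of a covering subgroup covers in the quotient. [folklore] -/
theorem map_mk_mem_coverers (N K : Subgroup G) [N.Normal] (hK : K ∈ coverers G) :
    K.map (QuotientGroup.mk' N) ∈ coverers (G ⧸ N) := by
  intro μ hμ
  have h1 : μ.comp (QuotientGroup.mk' N) = 1 := hK _ fun k hk => by
    rw [MonoidHom.mem_ker, MonoidHom.comp_apply]
    exact hμ (Subgroup.mem_map_of_mem _ hk)
  refine MonoidHom.ext fun q => ?_
  obtain ⟨g, rfl⟩ := QuotientGroup.mk_surjective q
  have h := DFunLike.congr_fun h1 g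
  rw [MonoidHom.comp_apply, QuotientGroup.mk'_apply] at h
  exact h

/-- **Quotient resolution**: `N ⊴ G`, `N ≤ K`, `K` covering and `AFB⁰(G/N)` give `π_K - 1 ∈ J(G)`
(`π_K - 1` is the inflation of `π_{K/N} - 1 ∈ linOrth(G/N) ⊆ J(G/N)`). [folklore] -/
theorem indOne_sub_one_mem_afSpan_of_quotient (N K : Subgroup G) [N.Normal] [Fintype (G ⧸ N)]
    (hNK : N ≤ K) (hK : K ∈ coverers G)
    (hAFq : linOrth (G ⧸ N) ⊆ (afSpan (G ⧸ N) : Set (G ⧸ N → ℂ))) :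
    indOne K - 1 ∈ afSpan G := by
  classical
  set Kb := K.map (QuotientGroup.mk' N) with hKb
  have hcomap : Kb.comap (QuotientGroup.mk' N) = K :=
    Subgroup.comap_map_eq_self (by rw [QuotientGroup.ker_mk']; exact hNK)
  have hmem : indOne Kb - 1 ∈ linOrth (G ⧸ N) :=
    ⟨Subring.sub_mem _ (indOne_mem_virtChars Kb) (Subring.one_mem _),
      fun _ hχ => classInner_indOne_sub_one (map_mk_mem_coverers N K hK) hχ⟩
  have hinf := comp_mk_mem_afSpan N (hAFq hmem)
  have hfun : (fun g : G => (indOne Kb - 1) (g : G ⧸ N)) = indOne K - 1 := by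
    funext g
    rw [Pi.sub_apply, Pi.sub_apply, Pi.one_apply, Pi.one_apply, sub_left_inj, indOne, indOne,
      ← indClassFun_comp_mk N Kb (fun _ => (1 : ℂ)) g]
    exact congrFun (indClassFun_congr_subgroup hcomap _ _ fun _ _ _ => rfl) g
  rw [hfun] at hinf
  exact hinf

end Moves


/-! ### The assembly at one group: hub + expansion ⇒ `AFB⁰` -/

section Final

variable [Fintype G]

/-- `linPart` of a finite sum. [folklore] -/
theorem linPart_sum {ι : Type*} (s : Finset ι) (F : ι → G → ℂ) :
    linPart G (∑ i ∈ s, F i) = ∑ i ∈ s, linPart G (F i) := by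
  classical
  exact Finset.induction_on s (by rw [Finset.sum_empty, Finset.sum_empty, linPart_zero])
    (fun a s ha ih => by rw [Finset.sum_insert ha, Finset.sum_insert ha, linPart_add, ih])

/-- `linPart` of a difference. [folklore] -/
theorem linPart_sub (f g : G → ℂ) : linPart G (f - g) = linPart G f - linPart G g := by
  rw [sub_eq_add_neg, linPart_add, ← neg_one_smul ℂ g, linPart_smul, neg_one_smul, ← sub_eq_add_neg]

/-- **The assembly lemma (one group).** Data: a covering *hub* `H₀`; a class `adm` of admissible
subgroups; for non-covering admissible `K` a function `e K` (in the application `e K = π_{hull K}`).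
Hypotheses: (h1) `π_K ≡ π_{H₀}` mod `J` for covering admissible `K`; (h2) `π_K ≡ e K`, (h3)
`e K · (π_{H₀} - 1) ∈ J`, (h4) `e K · μ` is fixed by `linPart`, for non-covering admissible `K`; (hexp) every
virtual character is, modulo `J`, a `ℤ`-combination of `π_K · μ` with `K` admissible and `μ` linear.
Conclusion: `AFB⁰(G)`, i.e. `linOrth G ⊆ J(G)`.  Proof: for `f ⊥ Λ`, `f ≡ S := Σ c_i A_i μ_i` with
`A_i ∈ {π_{H₀}, e K_i}`; applying `linPart` (which kills `f` and `J`) gives `Σ c_i B_i μ_i = 0`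
(`B_i ∈ {1, e K_i}`), and `S = π_{H₀} · (Σ c_i B_i μ_i) - Σ c_i D_i (π_{H₀} - 1) μ_i` with
`D_i ∈ {0, e K_i}`, whose last sum lies in `J`. [folklore] -/
theorem linOrth_subset_afSpan_of_hub (H₀ : Subgroup G) (hH₀ : H₀ ∈ coverers G)
    (adm : Set (Subgroup G)) (e : Subgroup G → (G → ℂ))
    (h1 : ∀ K ∈ adm, K ∈ coverers G → indOne K - indOne H₀ ∈ afSpan G)
    (h2 : ∀ K ∈ adm, K ∉ coverers G → indOne K - e K ∈ afSpan G)
    (h3 : ∀ K ∈ adm, K ∉ coverers G → e K * (indOne H₀ - 1) ∈ afSpan G)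
    (h4 : ∀ K ∈ adm, K ∉ coverers G → ∀ μ : G →* ℂˣ,
      linPart G (e K * fun g => (μ g : ℂ)) = e K * fun g => (μ g : ℂ))
    (hexp : ∀ f ∈ virtChars G, ∃ (ι : Type) (_ : Fintype ι) (c : ι → ℤ) (μ : ι → (G →* ℂˣ))
      (K : ι → Subgroup G), (∀ i, K i ∈ adm) ∧
        f - ∑ i, (c i : ℂ) • (indOne (K i) * fun g => (μ i g : ℂ)) ∈ afSpan G) :
    linOrth G ⊆ (afSpan G : Set (G → ℂ)) := by
  classical
  intro f hf
  obtain ⟨ι, _, c, μ, K, hK, hrem⟩ := hexp f hf.1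
  -- the three auxiliary families
  let A : ι → G → ℂ := fun i => if K i ∈ coverers G then indOne H₀ else e (K i)
  let B : ι → G → ℂ := fun i => if K i ∈ coverers G then 1 else e (K i)
  let D : ι → G → ℂ := fun i => if K i ∈ coverers G then 0 else e (K i)
  have hA : ∀ i, indOne (K i) - A i ∈ afSpan G := fun i => by
    by_cases h : K i ∈ coverers G
    · simp only [A, if_pos h]
      exact h1 _ (hK i) h
    · simp only [A, if_neg h]
      exact h2 _ (hK i) h
  have hB : ∀ i, linPart G (A i * fun g => (μ i g : ℂ)) = B i * fun g => (μ i g : ℂ) := fun i => by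
    by_cases h : K i ∈ coverers G
    · simp only [A, B, if_pos h, one_mul]
      exact linPart_indOne_mul hH₀ (Submodule.subset_span (coe_mem_linF (μ i)))
    · simp only [A, B, if_neg h]
      exact h4 _ (hK i) h (μ i)
  have hC : ∀ i, A i = B i * indOne H₀ - D i * (indOne H₀ - 1) := fun i => by
    by_cases h : K i ∈ coverers G
    · simp only [A, B, D, if_pos h, one_mul, zero_mul, sub_zero]
    · simp only [A, B, D, if_neg h]
      ring
  have hD : ∀ i, D i * (indOne H₀ - 1) ∈ afSpan G := fun i => by
    by_cases h : K i ∈ coverers G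
    · simp only [D, if_pos h, zero_mul]
      exact zero_mem _
    · simp only [D, if_neg h]
      exact h3 _ (hK i) h
  -- `f ≡ S` modulo `J`
  set S : G → ℂ := ∑ i, (c i : ℂ) • (A i * fun g => (μ i g : ℂ)) with hS
  have hTS : (∑ i, (c i : ℂ) • (indOne (K i) * fun g => (μ i g : ℂ))) - S =
      ∑ i, (c i : ℂ) • ((indOne (K i) - A i) * fun g => (μ i g : ℂ)) := by
    rw [hS, ← Finset.sum_sub_distrib]
    refine Finset.sum_congr rfl fun i _ => ?_
    rw [← smul_sub, sub_mul]
  have hfS : f - S ∈ afSpan G := by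
    rw [← sub_add_sub_cancel f (∑ i, (c i : ℂ) • (indOne (K i) * fun g => (μ i g : ℂ))) S, hTS]
    exact add_mem hrem (sum_mem fun i _ =>
      intCast_smul_mem_afSpan (mul_coe_mem_afSpan (hA i) (μ i)) (c i))
  -- the linear part of `S` vanishes
  have hLS : linPart G S = ∑ i, (c i : ℂ) • (B i * fun g => (μ i g : ℂ)) := by
    rw [hS, linPart_sum]
    exact Finset.sum_congr rfl fun i _ => by rw [linPart_smul, hB i]
  have hLB : ∑ i, (c i : ℂ) • (B i * fun g => (μ i g : ℂ)) = 0 := by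
    have h0 : linPart G (f - S) = 0 := linPart_of_mem_afSpan hfS
    rw [linPart_sub, linPart_eq_zero_of_orth hf.2, zero_sub, neg_eq_zero, hLS] at h0
    exact h0
  -- rewrite `S`
  have hSeq : S = indOne H₀ * (∑ i, (c i : ℂ) • (B i * fun g => (μ i g : ℂ))) -
      ∑ i, (c i : ℂ) • ((D i * (indOne H₀ - 1)) * fun g => (μ i g : ℂ)) := by
    rw [hS, Finset.mul_sum, ← Finset.sum_sub_distrib]
    refine Finset.sum_congr rfl fun i _ => ?_
    rw [hC i]
    simp only [Algebra.smul_def]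
    ring
  have hSmem : S ∈ afSpan G := by
    rw [hSeq, hLB, mul_zero, zero_sub]
    exact neg_mem (sum_mem fun i _ =>
      intCast_smul_mem_afSpan (mul_coe_mem_afSpan (hD i) (μ i)) (c i))
  rw [show f = (f - S) + S from (sub_add_cancel f S).symm]
  exact add_mem hfS hSmem

end Final

end Summit.Langlands.Langlands.Theorems.AbelianFreeBrauer

end
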